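import Literature.MathematicalPhysics.QuantumFieldTheory.BalabanImbrieJaffe1984to88.BIJ88Passage593Regime

/-!
# `BalabanImbrieJaffe1984to88.BIJ88Ineq593Model` — T. Bałaban, J. Imbrie, A. Jaffe, *Effective action and cluster
properties of the abelian Higgs model*, Commun. Math. Phys. **114** (1988) 257–315 [BalabanImbrieJaffe1988]:
**(5.9.3)** p. 296 [PDF 40], verbatim *"we wish to prove that |u_{k+1}(⟨b₋,b₊⟩)ψ(b₊) − ψ(b₋)| ≡ |(D_{ū_{k+1}}ψ)(b)| ≦ cp(e_k),
b ∈ Λ₀^{(k)′*}. (5.9.3) We prove the bound first for D_{ū_k}ψ … Our bounds on ψ − Q(u_k)φ reduce this to estimating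
|u_k(Γ_{b₋,x})φ(x) − u_k(⟨b₋,b₊⟩)u_k(Γ_{b₊,x′})φ(x′)| … This is proven with several applications of our bounds on D_{ū_k}φ. In going
from u_k to u_{k+1} … we make errors of the order of … In both cases this is bounded by e^β(L^kε/ε₀)^{1/4−α} … The desired bound
follows."* — the WHOLE printed proof ASSEMBLED ON ONE CARRIER (kind «model instance / knit» for row **C2.Eq5.9.3**; one theorem
+ two kernel lemmas; no definitions, no named facts).

statement-level skeleton of published theorems with citation tags; proofs where landed; nothing here is a claim about the Yang–Mills mass gap

PDF held: `paper:balaban1988-cmp114-bij-abelian-higgs-effective-action` (journal page = PDF page + 256); p. 296–297 [PDF 40–41] read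
this session from the text layer; (5.2.2) p. 278 as consumed by p02 g6's `BIJ88Restr592Proof.restr592_of_restrictions`.

CITATION HEADER (lean-in-tree rule).  Part of the lit-balaban TYPED SKELETON (HOME `run/shared/lean/pub/lit-balaban/`), Phase 2,
seat p02 gen 7 (unit `lit-balaban-p02`); row **C2.Eq5.9.3** of `HOME/lit-balaban-r16/ROWS-C2-part2.md` (fold owner r16, referee
ref-5).  The carrier is p36 g3's (`BIJ88Ineq593Proof.ineq593_first`): the fine `η`-lattice `Site P j` with the unit-modulus bond field
`u = u_k` and the fine scalar field `φ`; the block lattice `Site P j′` carrying `ψ`, the region `Λ₀′ = Λ₀^{(k)′}`, blocks `B(y) ⊂ T_η`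
with `|B(y)|·w = 1`, base points and contours `Γ_{y,x}` (`IsPath`, lengths `≤ n_Γ`) defining `Q(u)φ = covAvg`; coarse bonds
`b ∈ PBond P j′` with the straight contour `line b` from `base b₋` to `base b₊` (length `≤ n_ℓ`), so that `ū_k(b) = transport u (line b)`
and `(D_{ū}ψ)(b) = covD 1 ū ψ b`; the region of bonds is `Λ₀′* = {b : b₋ ∈ Λ₀′ ∧ b₊ ∈ Λ₀′}`.
WHAT IS PROVED HERE: **`ineq593_model`** — for d = 2, 3, `0 < λ ≤ 1`, `p > 0`, `0 < α ≤ ¼`, `0 ≤ β < 1`, `c_δ ≥ 0` and block geometry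
constants `n_Γ, n_ℓ` there is `e₀ > 0` (depending on these only) such that for every bare charge `0 < e ≤ e₀` and scale
`0 < s = L^kε ≤ ε₀ ≤ e^β` (p. 273), with `e_k = s^{(4−d)/2}e`, `λ_k = s^{4−d}λ` (2.2), `p(e_k)` (2.33): the restrictions (5.2.2) —
`|ψ − Q(u_k)φ| ≤ p(e_k)` on `Λ₀′`, `|D_{u_k}φ| ≤ p(e_k)` on the bonds of the contours and lines, `|φ| ≤ p(e_k)λ_k^{−1/4}` on the blocks
(regime `s^d < λ`; the (4.5)/(5.9.2) radius, T10) resp. `||φ(base y)| − (8λ)^{−1/2}s^{(d−2)/2}| ≤ p(e_k)s^{−1}` (regime `λ ≤ s^d`) — together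
with the gauge-defect datum `|ū_{k+1}(b) − ū_k(b)| ≤ c_δe_kp(e_k)²` on `Λ₀′*` (prose in print: *"the gauge transformation was not quite
compensated by a rotation of ψ"*) give **`Ineq593 (PBond P j′) (· ∈ Λ₀′*) (D_{ū_{k+1}}ψ) (2 + (2n_Γ + n_ℓ) + 1) p(e_k)`**.
HOW: first step = p36's `ineq593_first` (c₁ = c₂ = 1); (5.9.2) = p02 g6's `restr592_of_restrictions` (c = 2 + n_Γ); passage = p02 g6's
`passage593_order`; regime = p02 g7's `passage593_bound_small/_large` + `vertex_le_one` + `one_le_pLog`; knit = `ineq593_of_passage`.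
v1.1: `ineq593_of_imp`, **`ineq593_model_starB`** (the same with the region written `b ∈ starB Λ₀′` = *"b ∈ Λ₀^{(k)′*}"*, the index set
of the `D_{ū_{k+1}}ψ` factor of r16's `chiNext`).
NOT here: the size of the gauge defect (datum), the insertion of `χ_{k+1,Λ₀^{(k)′}}` (`BIJ88Restr592Proof.chiNext_eq_one`); no Summits import.
-/

namespace Literature.MathematicalPhysics.QuantumFieldTheory.BalabanImbrieJaffe1984to88.BIJ88Ineq593Model

open Literature.MathematicalPhysics.QuantumFieldTheory.Balaban1983to89
open BIJ88Sect2Statements (pLog)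
open BIJ88Sect3Statements BIJ88Sect5StatementsPart2 BIJ88Sect5StatementsPart4 BIJ88Ineq593Proof BIJ88Restr592Proof
  BIJ88ChargePowerLogScale BIJ88Passage593Regime

variable {P : Params} {j j' : ℕ}

/-- kernel: `(D_ū ψ)(b) = ū(b)ψ(b₊) − ψ(b₋)` — r16's `covD` at coupling `1` is p36's expression `transport u (line b)·ψ(tgt b) − ψ(src b)`
once `ū(b) = transport u (line b)`. [cite: BalabanImbrieJaffe1988, (5.9.3) p.296] -/
theorem covD_one_apply (ubar : PBond P j' → ℂ) (ψ : Balaban1983to89.Site P j' → ℂ) (b : PBond P j') :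
    covD 1 ubar ψ b = ubar b * ψ b.tgt - ψ b.src := by
  simp [covD]

/-- kernel: a bound on `|D_uφ|` along `Γ_{y,x}`, along the line and along `Γ_{y′,x′}` is a bound along p36's reduction path
`Γ_{y,x}` reversed ++ line ++ `Γ_{y′,x′}` (*"several applications of our bounds on D_{ū_k}φ"*). [cite: BalabanImbrieJaffe1988, (5.9.3) p.296] -/
theorem norm_covD_le_of_mem_path (u : PBond P j → ℂ) (φ : Balaban1983to89.Site P j → ℂ) {Γ₁ ℓ Γ₂ : Contour P j} {K : ℝ}
    (h₁ : ∀ sg ∈ Γ₁, ‖covD 1 u φ sg.1‖ ≤ K) (hℓ : ∀ sg ∈ ℓ, ‖covD 1 u φ sg.1‖ ≤ K) (h₂ : ∀ sg ∈ Γ₂, ‖covD 1 u φ sg.1‖ ≤ K) :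
    ∀ sg ∈ (Γ₁.reverse.map fun s => (s.1, !s.2)) ++ ℓ ++ Γ₂, ‖covD 1 u φ sg.1‖ ≤ K := by
  intro sg hsg
  simp only [List.mem_append, List.mem_map, List.mem_reverse] at hsg
  rcases hsg with (⟨s', hs', rfl⟩ | h) | h
  · exact h₁ s' hs'
  · exact hℓ sg h
  · exact h₂ sg h

/-- **(5.9.3) END TO END in the model** — see the module docstring: the (5.2.2) restrictions on `(u_k, φ, ψ)` over the region, the
block/contour geometry, and the gauge-defect datum for `ū_{k+1}` give `|(D_{ū_{k+1}}ψ)(b)| ≤ (2 + (2n_Γ + n_ℓ) + 1)·p(e_k)` on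
`Λ₀′*`, for every bare charge `e ≤ e₀(c_δ, n_Γ, λ, p, α, β, d)` and every scale `0 < L^kε ≤ ε₀ ≤ e^β`, d = 2, 3.
[cite: BalabanImbrieJaffe1988, (5.9.3) p.296–297] -/
theorem ineq593_model {d : ℕ} (hd2 : 2 ≤ d) (hd : d ≤ 3) {cδ lam p α β : ℝ} (hcδ : 0 ≤ cδ) (hlam : 0 < lam) (hlam1 : lam ≤ 1)
    (hp : 0 < p) (hα : 0 < α) (hα4 : α ≤ 1 / 4) (hβ0 : 0 ≤ β) (hβ : β < 1) (nΓ nℓ : ℕ) :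
    ∃ e₀ > 0, ∀ e s ε₀ : ℝ, 0 < e → e ≤ e₀ → 0 < s → s ≤ ε₀ → ε₀ ≤ e ^ β →
      ∀ {ek lamk pek : ℝ}, ek = s ^ ((4 - (d : ℝ)) / 2) * e → lamk = s ^ (4 - (d : ℝ)) * lam → pek = pLog p ek →
      ∀ (u : PBond P j → ℂ) (_ : ∀ b, ‖u b‖ = 1) (φ : Balaban1983to89.Site P j → ℂ)
        (B : Balaban1983to89.Site P j' → Finset (Balaban1983to89.Site P j)) (w : ℝ) (_ : 0 ≤ w)
        (base : Balaban1983to89.Site P j' → Balaban1983to89.Site P j)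
        (Γ : Balaban1983to89.Site P j' → Balaban1983to89.Site P j → Contour P j) (ψ : Balaban1983to89.Site P j' → ℂ)
        (Λ0' : Finset (Balaban1983to89.Site P j')) (line : PBond P j' → Contour P j) (ubar' : PBond P j' → ℂ),
        -- block and contour geometry
        (∀ y ∈ Λ0', ((B y).card : ℝ) * w = 1) →
        (∀ z, ∀ x ∈ B z, IsPath (base z) (Γ z x) x) → (∀ z, ∀ x ∈ B z, (Γ z x).length ≤ nΓ) →
        (∀ b : PBond P j', b.src ∈ Λ0' → b.tgt ∈ Λ0' → IsPath (base b.src) (line b) (base b.tgt)) →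
        (∀ b : PBond P j', b.src ∈ Λ0' → b.tgt ∈ Λ0' → (line b).length ≤ nℓ) →
        -- the restrictions (5.2.2)
        (∀ y ∈ Λ0', ‖ψ y - covAvg B w (fun z x => transport u (Γ z x)) φ y‖ ≤ pek) →
        (s ^ d < lam → ∀ y ∈ Λ0', ∀ x ∈ B y, ‖φ x‖ ≤ pek * lamk ^ (-(1 / 4 : ℝ))) →
        (lam ≤ s ^ d → ∀ y ∈ Λ0', |‖φ (base y)‖ - (8 * lam) ^ (-(1 / 2 : ℝ)) * s ^ (((d : ℝ) - 2) / 2)| ≤ pek * s⁻¹) →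
        (∀ y ∈ Λ0', ∀ x ∈ B y, ∀ sg ∈ Γ y x, ‖covD 1 u φ sg.1‖ ≤ pek) →
        (∀ b : PBond P j', b.src ∈ Λ0' → b.tgt ∈ Λ0' → ∀ sg ∈ line b, ‖covD 1 u φ sg.1‖ ≤ pek) →
        -- the gauge defect of the passage ū_k → ū_{k+1} (prose in print)
        (∀ b : PBond P j', b.src ∈ Λ0' → b.tgt ∈ Λ0' → ‖ubar' b - transport u (line b)‖ ≤ cδ * ek * pek ^ 2) →
        Ineq593 (PBond P j') (fun b => b.src ∈ Λ0' ∧ b.tgt ∈ Λ0') (covD 1 ubar' ψ) (2 + (2 * nΓ + nℓ) + 1) pek := by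
  have hcR : (0 : ℝ) ≤ 2 + nΓ := by positivity
  obtain ⟨eA, heA, hA⟩ :=
    passage593_bound_small hd (c := cδ * (2 + (nΓ : ℝ))) (mul_nonneg hcδ hcR) hlam hp hα hα4 hβ0 hβ
  obtain ⟨eB, heB, hB⟩ :=
    passage593_bound_large hd2 hd (c := cδ * (1 + (2 + (nΓ : ℝ)))) (mul_nonneg hcδ (by linarith)) hlam hp hα hα4 hβ0 hβ
  refine ⟨min (Real.exp (-1)) (min eA eB), lt_min (Real.exp_pos _) (lt_min heA heB), ?_⟩
  intro e s ε₀ he hele hs hsε₀ hε₀e ek lamk pek hek hlamk hpek u hu φ B w hw base Γ ψ Λ0' line ubar' hBw hΓ hlenΓ hline hlenℓ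
    hψ hφsmall hφlarge hDΓ hDline hδ
  -- scalars
  have hd3 : (d : ℝ) ≤ 3 := by exact_mod_cast hd
  have hm0 : 0 ≤ (4 - (d : ℝ)) / 2 := by linarith
  have heexp : e ≤ Real.exp (-1) := hele.trans (min_le_left _ _)
  have he1 : e ≤ 1 := heexp.trans (Real.exp_le_one_iff.2 (by norm_num))
  have heA' : e ≤ eA := (hele.trans (min_le_right _ _)).trans (min_le_left _ _)
  have heB' : e ≤ eB := (hele.trans (min_le_right _ _)).trans (min_le_right _ _)
  have hε₀ : 0 < ε₀ := hs.trans_le hsε₀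
  have hs1 : s ≤ 1 := hsε₀.trans (hε₀e.trans (Real.rpow_le_one he.le he1 hβ0))
  have hek0 : 0 < ek := by rw [hek]; exact mul_pos (Real.rpow_pos_of_pos hs _) he
  have hek1 : ek ≤ Real.exp (-1) := by
    rw [hek]
    calc s ^ ((4 - (d : ℝ)) / 2) * e ≤ 1 * e := mul_le_mul_of_nonneg_right (Real.rpow_le_one hs.le hs1 hm0) he.le
      _ = e := one_mul _
      _ ≤ Real.exp (-1) := heexp
  have hp1 : 1 ≤ pek := by rw [hpek]; exact one_le_pLog hp.le hek0 hek1
  have hpek0 : 0 ≤ pek := zero_le_one.trans hp1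
  have hlamk0 : 0 < lamk := by rw [hlamk]; exact mul_pos (Real.rpow_pos_of_pos hs _) hlam
  have hlamk1 : lamk ≤ 1 := by
    rw [hlamk]
    calc s ^ (4 - (d : ℝ)) * lam ≤ 1 * 1 :=
        mul_le_mul (Real.rpow_le_one hs.le hs1 (by linarith)) hlam1 hlam.le zero_le_one
      _ = 1 := one_mul _
  -- (5.9.2) from the restrictions (p02 g6)
  have h592 : Restr592 (2 + nΓ) pek lamk lam s d Λ0' ψ :=
    restr592_of_restrictions u hu φ B w hw base Γ ψ Λ0' hpek0 hs hs1 hlamk0 hlamk1 hBw (fun y _ x hx => hΓ y x hx)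
      (fun y _ x hx => hlenΓ y x hx) hψ hφsmall hφlarge (fun _ => hDΓ)
  -- the first step (p36 g3), for ū_k(b) = transport u (line b)
  have hfirst := ineq593_first u hu φ B w hw base Γ ψ (fun b : PBond P j' => b.src) (fun b => b.tgt) line
    (fun b : PBond P j' => b.src ∈ Λ0' ∧ b.tgt ∈ Λ0') (c₁ := 1) (c₂ := 1) (nΓ := nΓ) (nℓ := nℓ) hpek0 zero_le_one
    (fun b hb => ⟨hBw _ hb.1, hBw _ hb.2⟩) hΓ hlenΓ (fun b hb => hline b hb.1 hb.2) (fun b hb => hlenℓ b hb.1 hb.2)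
    (fun b hb => ⟨(hψ _ hb.1).trans_eq (one_mul _).symm, (hψ _ hb.2).trans_eq (one_mul _).symm⟩)
    (fun b hb x hx x' hx' sg hsg => (norm_covD_le_of_mem_path u φ (hDΓ _ hb.1 x hx) (hDline b hb.1 hb.2)
      (hDΓ _ hb.2 x' hx') sg hsg).trans_eq (one_mul _).symm)
  have hfirst' : Ineq593 (PBond P j') (fun b => b.src ∈ Λ0' ∧ b.tgt ∈ Λ0') (covD 1 (fun b => transport u (line b)) ψ)
      (2 + (2 * nΓ + nℓ)) pek := by
    intro b hb
    rw [covD_one_apply]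
    calc ‖transport u (line b) * ψ b.tgt - ψ b.src‖ ≤ (2 * 1 + (2 * nΓ + nℓ) * 1) * pek := hfirst b hb
      _ = (2 + (2 * nΓ + nℓ)) * pek := by ring
  -- the vertex factor is ≤ 1 ≤ p(e_k)
  have hV : e ^ β * (s / ε₀) ^ (1 / 4 - α) ≤ pek := (vertex_le_one he he1 hβ0 hs hsε₀ hα4).trans hp1
  refine ineq593_of_passage (fun b : PBond P j' => b.src ∈ Λ0' ∧ b.tgt ∈ Λ0') (covD 1 (fun b => transport u (line b)) ψ)
    (covD 1 ubar' ψ) hfirst' ?_ hV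
  intro b hb
  have hord := passage593_order h592 hcR hcδ hek0.le hp1 hlam hs (fun b => transport u (line b)) ubar' hb.2 (hδ b hb.1 hb.2)
  by_cases hreg : lam ≤ s ^ d
  · have h := hord.2 hreg
    have hEB := hB e s ε₀ he heB' hs hs1 hε₀ hε₀e hreg
    rw [← hek, ← hpek] at hEB
    linarith
  · have h := hord.1 (lt_of_not_ge hreg)
    have hEA := hA e s ε₀ he heA' hs hs1 hε₀ hε₀e
    rw [← hek, ← hlamk, ← hpek] at hEA
    linarith

/-! ## (v1.1, append-only) The region as r18's `Λ₀′* = starB Λ₀′` — the index set of the third product of `χ_{k+1,Λ₀^{(k)′}}` -/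

/-- `Ineq593` is monotone in the region predicate. [cite: BalabanImbrieJaffe1988, (5.9.3) p.296] -/
theorem ineq593_of_imp {Bond : Type} {R₁ R₂ : Bond → Prop} {Dψ : Bond → ℂ} {c pek : ℝ} (h : Ineq593 Bond R₁ Dψ c pek)
    (hR : ∀ b, R₂ b → R₁ b) : Ineq593 Bond R₂ Dψ c pek :=
  fun b hb => h b (hR b hb)

/-- **(5.9.3) END TO END, region written as printed** *"b ∈ Λ₀^{(k)′*}"* = r18's `starB Λ₀′` (bonds with both ends in `Λ₀′`,
`BIJ88Sect3Statements.mem_starB`) — the index set of the factor `Π_{b∈Λ₀^{(k)′*}} χ(cp(e_k), |(D_{ū_{k+1}}ψ)(b)|)` of r16's `chiNext`, so that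
(with `(2 + (2n_Γ + n_ℓ) + 1) ≤ (9/10)c`) the conclusion feeds the `hD` hypothesis of p02 g6's `BIJ88Restr592Proof.chiNext_eq_one`
(*"and the integral is unchanged"*). Same hypotheses as `ineq593_model`. [cite: BalabanImbrieJaffe1988, (5.9.3) p.296–297] -/
theorem ineq593_model_starB {d : ℕ} (hd2 : 2 ≤ d) (hd : d ≤ 3) {cδ lam p α β : ℝ} (hcδ : 0 ≤ cδ) (hlam : 0 < lam) (hlam1 : lam ≤ 1)
    (hp : 0 < p) (hα : 0 < α) (hα4 : α ≤ 1 / 4) (hβ0 : 0 ≤ β) (hβ : β < 1) (nΓ nℓ : ℕ) :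
    ∃ e₀ > 0, ∀ e s ε₀ : ℝ, 0 < e → e ≤ e₀ → 0 < s → s ≤ ε₀ → ε₀ ≤ e ^ β →
      ∀ {ek lamk pek : ℝ}, ek = s ^ ((4 - (d : ℝ)) / 2) * e → lamk = s ^ (4 - (d : ℝ)) * lam → pek = pLog p ek →
      ∀ (u : PBond P j → ℂ) (_ : ∀ b, ‖u b‖ = 1) (φ : Balaban1983to89.Site P j → ℂ)
        (B : Balaban1983to89.Site P j' → Finset (Balaban1983to89.Site P j)) (w : ℝ) (_ : 0 ≤ w)
        (base : Balaban1983to89.Site P j' → Balaban1983to89.Site P j)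
        (Γ : Balaban1983to89.Site P j' → Balaban1983to89.Site P j → Contour P j) (ψ : Balaban1983to89.Site P j' → ℂ)
        (Λ0' : Finset (Balaban1983to89.Site P j')) (line : PBond P j' → Contour P j) (ubar' : PBond P j' → ℂ),
        (∀ y ∈ Λ0', ((B y).card : ℝ) * w = 1) →
        (∀ z, ∀ x ∈ B z, IsPath (base z) (Γ z x) x) → (∀ z, ∀ x ∈ B z, (Γ z x).length ≤ nΓ) →
        (∀ b : PBond P j', b.src ∈ Λ0' → b.tgt ∈ Λ0' → IsPath (base b.src) (line b) (base b.tgt)) →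
        (∀ b : PBond P j', b.src ∈ Λ0' → b.tgt ∈ Λ0' → (line b).length ≤ nℓ) →
        (∀ y ∈ Λ0', ‖ψ y - covAvg B w (fun z x => transport u (Γ z x)) φ y‖ ≤ pek) →
        (s ^ d < lam → ∀ y ∈ Λ0', ∀ x ∈ B y, ‖φ x‖ ≤ pek * lamk ^ (-(1 / 4 : ℝ))) →
        (lam ≤ s ^ d → ∀ y ∈ Λ0', |‖φ (base y)‖ - (8 * lam) ^ (-(1 / 2 : ℝ)) * s ^ (((d : ℝ) - 2) / 2)| ≤ pek * s⁻¹) →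
        (∀ y ∈ Λ0', ∀ x ∈ B y, ∀ sg ∈ Γ y x, ‖covD 1 u φ sg.1‖ ≤ pek) →
        (∀ b : PBond P j', b.src ∈ Λ0' → b.tgt ∈ Λ0' → ∀ sg ∈ line b, ‖covD 1 u φ sg.1‖ ≤ pek) →
        (∀ b : PBond P j', b.src ∈ Λ0' → b.tgt ∈ Λ0' → ‖ubar' b - transport u (line b)‖ ≤ cδ * ek * pek ^ 2) →
        Ineq593 (PBond P j') (fun b => b ∈ starB Λ0') (covD 1 ubar' ψ) (2 + (2 * nΓ + nℓ) + 1) pek := by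
  obtain ⟨e₀, he₀, h⟩ := ineq593_model (P := P) (j := j) (j' := j') hd2 hd hcδ hlam hlam1 hp hα hα4 hβ0 hβ nΓ nℓ
  refine ⟨e₀, he₀, ?_⟩
  intro e s ε₀ he hele hs hsε₀ hε₀e ek lamk pek hek hlamk hpek u hu φ B w hw base Γ ψ Λ0' line ubar' hBw hΓ hlenΓ hline hlenℓ
    hψ hφsmall hφlarge hDΓ hDline hδ
  exact ineq593_of_imp (h e s ε₀ he hele hs hsε₀ hε₀e hek hlamk hpek u hu φ B w hw base Γ ψ Λ0' line ubar' hBw hΓ hlenΓ hline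
    hlenℓ hψ hφsmall hφlarge hDΓ hDline hδ) fun b hb => (mem_starB Λ0' b).1 hb

end Literature.MathematicalPhysics.QuantumFieldTheory.BalabanImbrieJaffe1984to88.BIJ88Ineq593Model
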